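import Literature.AlgebraicGeometry.HodgeTheory.AbelianVarietyFixedPointsFiniteness
import Literature.NumberTheory.LFunctions.FrobeniusCharpolyOfDet
import HarnessLib

/-!
# `#Fix(f(ℂ)ⁿ) = ∏ᵢ (1 - αᵢⁿ) = ∏ᵢ (αᵢⁿ - 1)` over the eigenvalues of `f(ℂ)^*` on `H¹(A(ℂ); ℚ)` (Alvarado–Auffarth's `F(n) = Δ_n(χ^r_f)`)

Lane `lit-hodgefound`, row A1-30⁺¹³ / (A1-30⁺¹²)⁺ / (A1-30⁺¹¹)⁺ / Q509⁺ (prover seat `lit-hodgefound-p31`; sequel of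
`AbelianVarietyFixedPointsFiniteness.lean` (`#Fix(f(ℂ)^[n]) = det(1 - (f(ℂ)^*)ⁿ | H¹(A(ℂ); ℚ))`) joined to the
tree's spectral mapping theorem for determinants
(`NumberTheory/LFunctions/FrobeniusCharpolyOfDet.lean`: `det(1 - Fʳ) = ∏ᵢ (1 - aᵢʳ)` over the eigenvalues
`aᵢ` of `F` in an algebraically closed extension, `FrobeniusCharpoly.algebraMap_det_one_sub_pow` — the
`ℓ`-adic formalism of Weil's `#A(𝔽_{qʳ}) = deg(1 - πʳ) = ∏ (1 - aᵢʳ)`, here read at the archimedean place).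

Printed statements.  M. Alvarado, R. Auffarth, *Fixed points of endomorphisms of complex tori*, J. Algebra
507 (2018) (held `paper:arxiv-1705.09681`): p0003 «Let `F(n) := #Fix(fⁿ)` denote the number of fixed points of
`fⁿ` if this number is finite, and `0` if not … `#Fix(fⁿ) = |∏_{i=1}^g (1 - λᵢⁿ)|²`» (eq. (1), `λᵢ` the
eigenvalues of `ρₐ(f)`); p0006 «`Δ_n(Q) := ∏_{i=1}^d (αᵢⁿ - 1)`» for `Q` with roots `α₁, …, α_d`, and, with
`χ_f^r(t)` «the characteristic polynomial of its action on `H_1(X, ℤ)`» (p0003), «Note moreover that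
`F(n) = Δ_n(χ_f^r)` (no absolute value is needed since for every root of `χ_f^r(t)`, its conjugate appears as a
root as well)»; I. Farmakis, M. Moskowitz, *Fixed Point Theorems and Their Applications* (2013), Lemma 3.5.17
(p0085) «`det(λI - A) = ∏ (λ - λᵢ)` … `Tr(⋀ᵏA) = Σ λ_{i₁}⋯λ_{i_k}`», §5.5.1 Thm. 5.5.5 (p0129–p0130)
«`N_k = |det(Aᵏ - I)|`»; H. Lange, *Abelian Varieties over the Complex Numbers* (2023), §1.1.3 Lemma 1.1.17 (a)
(p0023) «`H¹(X, ℤ) → Hom(Λ, ℤ)`» (so `χ(f^* | H¹) = χ(f_* | H₁) = χ_f^r`), §2.4.1 Prop. 2.4.3 (b) (p0114).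

For a complex abelian variety `A` of dimension `g` (`Motives.AbelianVariety ℂ`) and a `ℂ`-morphism
`f : A.X ⟶ A.X` (an arbitrary algebraic self-map), write `T := f(ℂ)^* = H¹(f(ℂ))` on `H¹(A(ℂ); ℚ)` and
`eigenvalues ℂ T` for the multiset of the `2g` complex roots of its characteristic polynomial `χ_T = χ^r`
(the tree's `FrobeniusCharpoly.eigenvalues`).  This file proves (theorems only; no definition, no named fact):

* §1 (a self-map `g` of `A(ℂ)` covered by a holomorphic translate `t_c ∘ mapMatrix M` of the analytifying
  torus): `finrank_singularCohomology_rat_one` (`dim_ℚ H¹(A(ℂ); ℚ) = |ι| = 2g`),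
  `card_eigenvalues_singularCohomology_map_one` (`2g` eigenvalues),
  **`natCard_fixedPoints_iterate_eq_prod_one_sub_pow_eigenvalues`** (`#Fix(g^[n]) = ∏ᵢ (1 - αᵢⁿ)`),
  **`natCard_fixedPoints_iterate_eq_prod_pow_sub_one_eigenvalues`** (`= ∏ᵢ (αᵢⁿ - 1) = Δ_n(χ^r)`, the
  number of eigenvalues being even), `natCard_fixedPoints_eq_prod_one_sub_eigenvalues` (`n = 1`),
  `alternatingSum_trace_eq_prod_one_sub_eigenvalues` (`Λ(g) = ∏ᵢ (1 - αᵢ)`, no holomorphy needed).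
* §2 algebraic `f`, §3 PARAMETER-FREE headlines:
  **`AbelianVariety.natCard_fixedPoints_iterate_eq_prod_one_sub_pow_eigenvalues`**
  (`#Fix(f(ℂ)^[n]) = ∏_{α ∈ eigenvalues ℂ (f(ℂ)^*|H¹)} (1 - αⁿ)` in `ℂ`, every `A`, `f`, `n`),
  **`AbelianVariety.natCard_fixedPoints_iterate_eq_prod_pow_sub_one_eigenvalues`** (`= ∏ (αⁿ - 1)`, Alvarado–Auffarth's
  `F(n) = Δ_n(χ_f^r)`), `AbelianVariety.natCard_fixedPoints_eq_prod_one_sub_eigenvalues`,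
  `AbelianVariety.alternatingSum_trace_eq_prod_one_sub_eigenvalues` (`Λ(f(ℂ)) = ∏ (1 - α)`),
  `AbelianVariety.card_eigenvalues_singularCohomology_map_one` (`= 2g`) and
  `AbelianVariety.finrank_singularCohomology_rat_one` (`b₁(A) = 2g`, from the uniformisation).

## References

* [AlvaradoAuffarth2018] M. Alvarado, R. Auffarth, *Fixed points of endomorphisms of complex tori*, J. Algebra
  507 (2018) 428–438, §1 eq. (1) (arXiv PDF p. 3), §3 (arXiv PDF p. 6).
* [FarmakisMoskowitz2013] I. Farmakis, M. Moskowitz, *Fixed Point Theorems and Their Applications* (2013),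
  Lemma 3.5.17 (PDF p. 85), §5.5.1 Thm. 5.5.5 (PDF pp. 129–130).
* [Lange2023AbelianVarietiesComplex] H. Lange, *Abelian Varieties over the Complex Numbers* (2023), §1.1.3
  Lemma 1.1.17 (a), Cor. 1.1.18 (PDF pp. 23, 27), §2.4.1 Prop. 2.4.3 (b) (PDF p. 114).
* [Milne1986AbelianVarieties] J. S. Milne, *Abelian Varieties* (1986), Thm. 19.1 (the finite-field twin
  `N_m = ∏ (1 - aᵢ^m)`; cite only).
-/

noncomputable section

-- `ComplexTorus Φ` (for `Φ : ℝ^ι ≃ E`) is the type `ι → ℝ/ℤ`; instance paths up to unfolding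
set_option backward.isDefEq.respectTransparency false
-- nested instance problems on the carriers `↥(rationalForms Φ k)` (cf. `ComplexTorusLefschetzZetaFunction.lean`)
set_option maxSynthPendingDepth 3

open scoped Manifold
open CategoryTheory Module Function Finset
open Literature.AlgebraicTopology.SingularHomology Literature.NumberTheory.Transcendental
  Literature.Geometry.Kaehler Literature.NumberTheory.LFunctions
open Literature.AlgebraicGeometry.Motives (ComplexPoints IsSmoothProjective AbelianVariety SchemeOver AlgPoints)

namespace Literature.AlgebraicGeometry.HodgeTheory

/-! ### §1 A self-map of `A(ℂ)` covered by a translate of a homomorphism of the torus -/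

section Transport

variable {ι : Type} [Fintype ι] [DecidableEq ι] {E : Type} [NormedAddCommGroup E] [NormedSpace ℂ E]
  [FiniteDimensional ℂ E] (Φ : (ι → ℝ) ≃L[ℝ] E) (A : AbelianVariety ℂ)
  (φ : C(ComplexTorus Φ, ComplexPoints A.X)) (hφ : IsAnalytification E A.X A.dim φ)
  (g : C(ComplexPoints A.X, ComplexPoints A.X)) (M : Matrix ι ι ℤ) (c : ComplexTorus Φ)
  (hg : ∀ t, φ (ComplexTorus.mapMatrix Φ Φ M t + c) = g (φ t))
  (hM : M.map (Int.cast : ℤ → ℝ) * ComplexTorus.jMatrix Φ = ComplexTorus.jMatrix Φ * M.map (Int.cast : ℤ → ℝ))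

include Φ φ hφ in
omit [DecidableEq ι] in
/-- **`b₁(A) = |ι| = 2g` over `ℚ`**: `dim_ℚ H¹(A(ℂ); ℚ) = |ι|` through the degree-one Betti–forms comparison
`E_1 : H¹(A(ℂ); ℚ) ≅ H¹(X, ℚ)_forms` of row A1-30 and `dim_ℚ H¹(X, ℚ) = C(|ι|, 1)` («`Hⁿ(X, ℤ)` is free of
rank `C(2g, n)`»). [cite: Lange2023AbelianVarietiesComplex, §1.1.3 Cor. 1.1.18 and Exercise 1.1.6 (8) (PDF p. 27)] -/
theorem finrank_singularCohomology_rat_one :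
    finrank ℚ (singularCohomology ℚ ℚ (ComplexPoints A.X) 1) = Fintype.card ι := by
  rw [(bettiFormsEquivDeg Φ A φ hφ 1).finrank_eq, ComplexTorus.finrank_rationalForms_eq_choose,
    Nat.choose_one_right]

include Φ φ hφ in
omit [DecidableEq ι] in
/-- **`f(ℂ)^*` has `|ι| = 2g` eigenvalues on `H¹(A(ℂ); ℚ)`** (roots in `ℂ` of `χ^r`, counted with multiplicity).
[cite: Lange2023AbelianVarietiesComplex, §2.4.1 (PDF p. 114): `P^r_f` is monic of degree `2g`] -/
theorem card_eigenvalues_singularCohomology_map_one :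
    Multiset.card (FrobeniusCharpoly.eigenvalues ℂ (singularCohomology.map ℚ ℚ g 1).hom) = Fintype.card ι := by
  rw [FrobeniusCharpoly.card_eigenvalues, finrank_singularCohomology_rat_one Φ A φ hφ]

include hφ hg hM in
/-- **`#Fix(g^[n]) = ∏ᵢ (1 - αᵢⁿ)`** in `ℂ`, over the eigenvalues `αᵢ` of `H¹(g)` on `H¹(A(ℂ); ℚ)` — for a self-map
`g` of `A(ℂ)` covered by a holomorphic translate `t_c ∘ mapMatrix M`: `#Fix(g^[n]) = det(1 - H¹(g)ⁿ)` (row A1-30⁺¹²)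
and `det(1 - Tⁿ) = ∏ᵢ (1 - αᵢⁿ)` (spectral mapping for the determinant, `FrobeniusCharpoly.algebraMap_det_one_sub_pow`).
[cite: AlvaradoAuffarth2018, §1 eq. (1) (arXiv PDF p. 3) and §3 (arXiv PDF p. 6)]
[cite: FarmakisMoskowitz2013, Lemma 3.5.17 (PDF p. 85)] -/
theorem natCard_fixedPoints_iterate_eq_prod_one_sub_pow_eigenvalues (n : ℕ) :
    (Nat.card (fixedPoints g^[n]) : ℂ) =
      ((FrobeniusCharpoly.eigenvalues ℂ (singularCohomology.map ℚ ℚ g 1).hom).map fun α ↦ 1 - α ^ n).prod := by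
  rw [← FrobeniusCharpoly.algebraMap_det_one_sub_pow,
    ← natCard_fixedPoints_iterate_eq_det_one_sub_pow Φ A φ hφ g M c hg hM n, map_natCast]

include hφ hg hM in
/-- **Alvarado–Auffarth's `F(n) = Δ_n(χ^r_f)`: `#Fix(g^[n]) = ∏ᵢ (αᵢⁿ - 1)`** — «no absolute value is needed»:
the number `2g` of eigenvalues is even, so `∏ (1 - αᵢⁿ) = ∏ (αᵢⁿ - 1)`.
[cite: AlvaradoAuffarth2018, §3 (arXiv PDF p. 6)] -/
theorem natCard_fixedPoints_iterate_eq_prod_pow_sub_one_eigenvalues (n : ℕ) :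
    (Nat.card (fixedPoints g^[n]) : ℂ) =
      ((FrobeniusCharpoly.eigenvalues ℂ (singularCohomology.map ℚ ℚ g 1).hom).map fun α ↦ α ^ n - 1).prod := by
  have heven : Even (Multiset.card (FrobeniusCharpoly.eigenvalues ℂ (singularCohomology.map ℚ ℚ g 1).hom)) := by
    rw [card_eigenvalues_singularCohomology_map_one Φ A φ hφ, card_eq_two_mul_finrank_of_periodIso Φ]
    exact even_two_mul _
  rw [natCard_fixedPoints_iterate_eq_prod_one_sub_pow_eigenvalues Φ A φ hφ g M c hg hM n]
  set s := FrobeniusCharpoly.eigenvalues ℂ (singularCohomology.map ℚ ℚ g 1).hom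
  have h : s.map (fun α : ℂ ↦ 1 - α ^ n) = (s.map fun α : ℂ ↦ α ^ n - 1).map Neg.neg := by
    rw [Multiset.map_map]
    exact Multiset.map_congr rfl fun α _ ↦ (neg_sub _ _).symm
  rw [h, Multiset.prod_map_neg, Multiset.card_map, heven.neg_one_pow, one_mul]

include hφ hg hM in
/-- **`#Fix(g) = ∏ᵢ (1 - αᵢ)`** over the eigenvalues of `H¹(g)` (the case `n = 1`; `= χ^r(1) = P^r(1)`).
[cite: Lange2023AbelianVarietiesComplex, §2.4.1 Prop. 2.4.3 (b) (PDF p. 114)] [cite: AlvaradoAuffarth2018, §1 eq. (1) (arXiv PDF p. 3)] -/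
theorem natCard_fixedPoints_eq_prod_one_sub_eigenvalues :
    (Nat.card (fixedPoints g) : ℂ) =
      ((FrobeniusCharpoly.eigenvalues ℂ (singularCohomology.map ℚ ℚ g 1).hom).map fun α ↦ 1 - α).prod := by
  simpa only [Function.iterate_one, pow_one] using
    natCard_fixedPoints_iterate_eq_prod_one_sub_pow_eigenvalues Φ A φ hφ g M c hg hM 1

include hφ hg in
/-- **`Λ(g) = Σ_k (-1)^k Tr(Hᵏ(g) | Hᵏ(A(ℂ); ℚ)) = ∏ᵢ (1 - αᵢ)`** over the eigenvalues of `H¹(g)` — for ANY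
self-map covered by a translate of a homomorphism, holomorphic or not («`det(I - A) = ∏ (1 - λᵢ) = Σ_j (-1)^j Tr(⋀ʲA)`»,
`Hᵏ = ⋀ᵏH¹`; row A1-30⁺¹² `alternatingSum_trace_eq_det_one_sub`). [cite: FarmakisMoskowitz2013, Lemma 3.5.17 (PDF p. 85) and §5.6 (PDF p. 135)] -/
theorem alternatingSum_trace_eq_prod_one_sub_eigenvalues :
    (algebraMap ℚ ℂ) (∑ k ∈ range (Fintype.card ι + 1), (-1 : ℚ) ^ k *
        LinearMap.trace ℚ (singularCohomology ℚ ℚ (ComplexPoints A.X) k) (singularCohomology.map ℚ ℚ g k).hom) =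
      ((FrobeniusCharpoly.eigenvalues ℂ (singularCohomology.map ℚ ℚ g 1).hom).map fun α ↦ 1 - α).prod := by
  rw [alternatingSum_trace_eq_det_one_sub Φ A φ hφ g M c hg]
  simpa only [pow_one] using
    FrobeniusCharpoly.algebraMap_det_one_sub_pow ℂ (singularCohomology.map ℚ ℚ g 1).hom 1

end Transport

/-! ### §2 Algebraic self-maps `f : A.X ⟶ A.X` -/

section Algebraic

variable {ι : Type} [Fintype ι] [DecidableEq ι] {E : Type} [NormedAddCommGroup E] [NormedSpace ℂ E]
  [FiniteDimensional ℂ E] (Φ : (ι → ℝ) ≃L[ℝ] E) (A : AbelianVariety ℂ)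
  (φ : C(ComplexTorus Φ, ComplexPoints A.X)) (hφ : IsAnalytification E A.X A.dim φ) (f : A.X ⟶ A.X)

include hφ in
/-- **`#Fix(f(ℂ)^[n]) = ∏ᵢ (1 - αᵢⁿ)`** over the eigenvalues of `f(ℂ)^*` on `H¹(A(ℂ); ℚ)`, for an algebraic self-map
`f` through an analytification by `E/Φ(ℤ^ι)` (GAGA + Prop. 1.1.6 (a): `f(ℂ)` is covered by a holomorphic
translate, row Q509 `exists_mapMatrix_add_comp_eq`). [cite: AlvaradoAuffarth2018, §1 eq. (1) (arXiv PDF p. 3)] -/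
theorem natCard_fixedPoints_iterate_mapContinuous_eq_prod_one_sub_pow_eigenvalues (n : ℕ) :
    (Nat.card (fixedPoints (AlgPoints.mapContinuous (L := ℂ) f)^[n]) : ℂ) =
      ((FrobeniusCharpoly.eigenvalues ℂ
          (singularCohomology.map ℚ ℚ (AlgPoints.mapContinuous (L := ℂ) f) 1).hom).map fun α ↦ 1 - α ^ n).prod := by
  obtain ⟨M, c, hM, hMc⟩ := exists_mapMatrix_add_comp_eq Φ A φ hφ f
  exact natCard_fixedPoints_iterate_eq_prod_one_sub_pow_eigenvalues Φ A φ hφ _ M c hMc hM n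

include hφ in
/-- **`#Fix(f(ℂ)^[n]) = ∏ᵢ (αᵢⁿ - 1)`** (`2g` eigenvalues). [cite: AlvaradoAuffarth2018, §3 (arXiv PDF p. 6)] -/
theorem natCard_fixedPoints_iterate_mapContinuous_eq_prod_pow_sub_one_eigenvalues (n : ℕ) :
    (Nat.card (fixedPoints (AlgPoints.mapContinuous (L := ℂ) f)^[n]) : ℂ) =
      ((FrobeniusCharpoly.eigenvalues ℂ
          (singularCohomology.map ℚ ℚ (AlgPoints.mapContinuous (L := ℂ) f) 1).hom).map fun α ↦ α ^ n - 1).prod := by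
  obtain ⟨M, c, hM, hMc⟩ := exists_mapMatrix_add_comp_eq Φ A φ hφ f
  exact natCard_fixedPoints_iterate_eq_prod_pow_sub_one_eigenvalues Φ A φ hφ _ M c hMc hM n

end Algebraic

/-! ### §3 The parameter-free headlines -/

section Headlines

variable (A : AbelianVariety ℂ) (f : A.X ⟶ A.X)

/-- **`b₁(A) = 2g`**: `dim_ℚ H¹(A(ℂ); ℚ) = 2 dim A` for every complex abelian variety (uniformisation
`complexAbelianVariety_torusUniformised_holds`, rank of the lattice `= 2 dim_ℂ`).
[cite: Lange2023AbelianVarietiesComplex, §1.1.3 Cor. 1.1.18 (PDF p. 27)] -/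
theorem AbelianVariety.finrank_singularCohomology_rat_one :
    finrank ℚ (singularCohomology ℚ ℚ (ComplexPoints A.X) 1) = 2 * A.dim := by
  obtain ⟨ι, _, _, Φ, φ, hφ, -⟩ := complexAbelianVariety_torusUniformised_holds A
  rw [HodgeTheory.finrank_singularCohomology_rat_one Φ A ⟨φ, hφ.isHomeomorph.continuous⟩ hφ,
    card_eq_two_mul_finrank_of_periodIso Φ, hφ.finrank_eq]

/-- **`f(ℂ)^*` has `2g` complex eigenvalues on `H¹(A(ℂ); ℚ)`** (with multiplicity; `χ^r` is monic of degree `2g`).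
[cite: Lange2023AbelianVarietiesComplex, §2.4.1 (PDF p. 114)] -/
theorem AbelianVariety.card_eigenvalues_singularCohomology_map_one :
    Multiset.card (FrobeniusCharpoly.eigenvalues ℂ
        (singularCohomology.map ℚ ℚ (AlgPoints.mapContinuous (L := ℂ) f) 1).hom) = 2 * A.dim := by
  rw [FrobeniusCharpoly.card_eigenvalues, AbelianVariety.finrank_singularCohomology_rat_one]

/-- **`#Fix(f(ℂ)ⁿ) = ∏ᵢ (1 - αᵢⁿ)`.** For every complex abelian variety `A`, every `ℂ`-morphism `f : A.X ⟶ A.X`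
and every `n`, the number of fixed points of the iterate `f(ℂ)^[n]` (`Nat.card`: «the number of fixed points of
`fⁿ` if this number is finite, and `0` if not») is, in `ℂ`, the product of `1 - αⁿ` over the `2g` eigenvalues
`α` of `f(ℂ)^*` on `H¹(A(ℂ); ℚ)` («`#Fix(fⁿ) = |∏_{i=1}^g (1 - λᵢⁿ)|²`» with the `2g` eigenvalues
`{λᵢ, λ̄ᵢ}` of `ρᵣ = ρₐ ⊕ ρ̄ₐ`). [cite: AlvaradoAuffarth2018, §1 eq. (1) (arXiv PDF p. 3)]
[cite: FarmakisMoskowitz2013, §5.5.1 Thm. 5.5.5 (PDF pp. 129–130) and Lemma 3.5.17 (PDF p. 85)] -/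
theorem AbelianVariety.natCard_fixedPoints_iterate_eq_prod_one_sub_pow_eigenvalues (n : ℕ) :
    (Nat.card (fixedPoints (AlgPoints.mapContinuous (L := ℂ) f)^[n]) : ℂ) =
      ((FrobeniusCharpoly.eigenvalues ℂ
          (singularCohomology.map ℚ ℚ (AlgPoints.mapContinuous (L := ℂ) f) 1).hom).map fun α ↦ 1 - α ^ n).prod := by
  obtain ⟨ι, _, _, Φ, φ, hφ, -⟩ := complexAbelianVariety_torusUniformised_holds A
  exact HodgeTheory.natCard_fixedPoints_iterate_mapContinuous_eq_prod_one_sub_pow_eigenvalues Φ A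
    ⟨φ, hφ.isHomeomorph.continuous⟩ hφ f n

/-- **Alvarado–Auffarth's `F(n) = Δ_n(χ^r_f)`: `#Fix(f(ℂ)ⁿ) = ∏ᵢ (αᵢⁿ - 1)`** over the `2g` eigenvalues of
`f(ℂ)^*` on `H¹(A(ℂ); ℚ)` — «`Δ_n(Q) := ∏_{i=1}^d (αᵢⁿ - 1)` … `F(n) = Δ_n(χ_f^r)` (no absolute value is needed
since for every root of `χ_f^r(t)`, its conjugate appears as a root as well)»; here: the number of roots is even.
[cite: AlvaradoAuffarth2018, §3 (arXiv PDF p. 6)] -/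
theorem AbelianVariety.natCard_fixedPoints_iterate_eq_prod_pow_sub_one_eigenvalues (n : ℕ) :
    (Nat.card (fixedPoints (AlgPoints.mapContinuous (L := ℂ) f)^[n]) : ℂ) =
      ((FrobeniusCharpoly.eigenvalues ℂ
          (singularCohomology.map ℚ ℚ (AlgPoints.mapContinuous (L := ℂ) f) 1).hom).map fun α ↦ α ^ n - 1).prod := by
  obtain ⟨ι, _, _, Φ, φ, hφ, -⟩ := complexAbelianVariety_torusUniformised_holds A
  exact HodgeTheory.natCard_fixedPoints_iterate_mapContinuous_eq_prod_pow_sub_one_eigenvalues Φ A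
    ⟨φ, hφ.isHomeomorph.continuous⟩ hφ f n

/-- **`#Fix(f(ℂ)) = ∏ᵢ (1 - αᵢ)`** over the eigenvalues of `f(ℂ)^*` on `H¹(A(ℂ); ℚ)`, for every `A` and `f`.
[cite: AlvaradoAuffarth2018, §1 eq. (1) (arXiv PDF p. 3)] [cite: Lange2023AbelianVarietiesComplex, §2.4.1 Prop. 2.4.3 (b) (PDF p. 114)] -/
theorem AbelianVariety.natCard_fixedPoints_eq_prod_one_sub_eigenvalues :
    (Nat.card (fixedPoints (AlgPoints.mapContinuous (L := ℂ) f)) : ℂ) =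
      ((FrobeniusCharpoly.eigenvalues ℂ
          (singularCohomology.map ℚ ℚ (AlgPoints.mapContinuous (L := ℂ) f) 1).hom).map fun α ↦ 1 - α).prod := by
  simpa only [Function.iterate_one, pow_one] using
    AbelianVariety.natCard_fixedPoints_iterate_eq_prod_one_sub_pow_eigenvalues A f 1

/-- **`Λ(f(ℂ)) = Σ_{k=0}^{2g} (-1)^k Tr(f(ℂ)^* | Hᵏ(A(ℂ); ℚ)) = ∏ᵢ (1 - αᵢ)`** over the eigenvalues of `f(ℂ)^*` on
`H¹(A(ℂ); ℚ)` («`det(I - A) = Σ_j (-1)^j Tr(⋀ʲA)`», `Hᵏ = ⋀ᵏH¹`).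
[cite: FarmakisMoskowitz2013, Lemma 3.5.17 (PDF p. 85) and §5.6 (PDF p. 135)] -/
theorem AbelianVariety.alternatingSum_trace_eq_prod_one_sub_eigenvalues :
    (algebraMap ℚ ℂ) (∑ k ∈ range (2 * A.dim + 1), (-1 : ℚ) ^ k *
        LinearMap.trace ℚ (singularCohomology ℚ ℚ (ComplexPoints A.X) k)
          (singularCohomology.map ℚ ℚ (AlgPoints.mapContinuous (L := ℂ) f) k).hom) =
      ((FrobeniusCharpoly.eigenvalues ℂ
          (singularCohomology.map ℚ ℚ (AlgPoints.mapContinuous (L := ℂ) f) 1).hom).map fun α ↦ 1 - α).prod := by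
  rw [AbelianVariety.alternatingSum_trace_eq_det_one_sub]
  simpa only [pow_one] using FrobeniusCharpoly.algebraMap_det_one_sub_pow ℂ
    (singularCohomology.map ℚ ℚ (AlgPoints.mapContinuous (L := ℂ) f) 1).hom 1

end Headlines

end Literature.AlgebraicGeometry.HodgeTheory

end
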